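import Mathlib
import HarnessLib
import Summits.HubbardSuperconductivity.HubbardSuperconductivity.Theorems.KLProgrammeSalmhoferCutoffDerivBound

/-!
# Route `KLProgramme` — engine support (cell gate-hubbard-kl, #22a (2e) «sharp χ₂ table», p2 g18): Cauchy estimates for all derivatives of
# Mathlib's `Real.smoothTransition` from its complexification

The engine's UV cutoff is `χ₂(x) = smoothTransition((4x−1)/3)` (`HubbardFreeCovariance.salmhoferCutoff`); every alias/tail threshold of crux
stmt-HubbardSuperconductivity-20437 stub (C) carries `sup|χ₂^{(l)}|`, for which the tree had the Gevrey-2 table `8·(l!)²·342ˡ` (`SalmhoferCutoffGevrey`)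
and sharp numerals only for `l ≤ 2`.  On `(0,1)`, `σ := smoothTransition = (1 + exp(1/x − 1/(1−x)))⁻¹`; its complexification
`F(z) = (1 + exp(1/z − 1/(1−z)))⁻¹` (`stC`) has poles only on the circle `|z − ½| = ½` (there `Re(1/z) = Re(1/(1−z)) = 1`), so `F` is holomorphic
on every disc `|z − x| ≤ r`, `r < x`, `x + r < 1`, on which `1 + exp ≠ 0`, with the majorants `‖F‖ ≤ 1/(e^τ − 1)`, `τ = 1/(x+r) − 1/(1−x−r)`
(from `Re(1/z) ≥ 1/(x+r)`, `Re(1/(1−z)) ≤ 1/(1−x−r)`), and `‖F‖ ≤ 1` (resp. `2`) when `r/(x²−r²) + r/((1−x)²−r²) ≤ 3/2` (resp. `5/2`) (the Möbius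
image of the disc under `1/w` has radius `r/(x²−r²)`; `|1 + e^{a+ib}| ≥ 1` for `|b| ≤ π/2`, `≥ |sin b|` always).  Cauchy's inequality
(`Complex.norm_iteratedDeriv_le_of_forall_mem_sphere_norm_le`) and the real/complex bridge `σ^{(n)}(x) = Re F^{(n)}(x)` give the three pointwise bounds
**`abs_iteratedDeriv_smoothTransition_le_of_re`** (`n!·(e^τ−1)⁻¹/rⁿ`), **`…_le_of_im`** (`n!/rⁿ`), **`…_le_two_of_im`** (`2·n!/rⁿ`); the global
tables are in `…KLProgrammeSmoothTransitionCauchyTable`.  Pure real/complex analysis (Krantz–Parks Prop. 2.2.10: Cauchy estimates), nothing about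
the model.  Everything is proved; one definition (`stC`); no named facts. [cite: KrantzParks2002, Prop. 2.2.10]
-/

noncomputable section

namespace Summit.HubbardSuperconductivity.HubbardSuperconductivity.Theorems.KLRegimeSplit

set_option linter.dupNamespace false -- summit = problem name (single-conjunct summit), D-0017

open Complex Set Metric Filter
open scoped Topology Nat Real

/-! ## §1 The complexification and its agreement with `Real.smoothTransition` on `(0,1)` -/

/-- The complexification `F(z) = (1 + exp(1/z − 1/(1−z)))⁻¹` of Mathlib's `Real.smoothTransition`.
[cite: KrantzParks2002, Prop. 2.2.10] -/
def stC (z : ℂ) : ℂ := (1 + Complex.exp (z⁻¹ - (1 - z)⁻¹))⁻¹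

/-- Agreement on `(0,1)`: `F(x) = σ(x)` for real `x ∈ (0,1)`. [cite: KrantzParks2002, Prop. 2.2.10] -/
theorem stC_ofReal {x : ℝ} (h0 : 0 < x) (h1 : x < 1) : stC (x : ℂ) = ((Real.smoothTransition x : ℝ) : ℂ) := by
  rw [klcd_smoothTransition_eq_logistic h0 h1, stC]
  push_cast
  rfl

/-! ## §2 Geometry of the disc `|z − x| ≤ r`, `0 < r < x` -/

section geometry

variable {x r : ℝ} {z : ℂ}

/-- On the disc: `‖z‖ ≥ x − r`. -/
theorem stC_norm_ge_sub_of_mem_disc (hz : ‖z - x‖ ≤ r) : x - r ≤ ‖z‖ := by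
  have h1 : ‖(x : ℂ)‖ ≤ ‖z‖ + ‖z - x‖ := by
    calc ‖(x : ℂ)‖ = ‖z - (z - x)‖ := by ring_nf
      _ ≤ ‖z‖ + ‖z - x‖ := norm_sub_le _ _
  linarith [show x ≤ ‖(x : ℂ)‖ by rw [Complex.norm_real]; exact le_abs_self x]

/-- On the disc: `‖1 − z‖ ≥ 1 − x − r`. -/
theorem stC_norm_one_sub_ge_of_mem_disc (hz : ‖z - x‖ ≤ r) : 1 - x - r ≤ ‖1 - z‖ := by
  have h1 : ‖(1 : ℂ) - x‖ ≤ ‖1 - z‖ + ‖z - x‖ := by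
    calc ‖(1 : ℂ) - x‖ = ‖(1 - z) + (z - x)‖ := by ring_nf
      _ ≤ ‖1 - z‖ + ‖z - x‖ := norm_add_le _ _
  have h2 : 1 - x ≤ ‖(1 : ℂ) - x‖ := by
    have : ((1 : ℂ) - x) = ((1 - x : ℝ) : ℂ) := by push_cast; ring
    rw [this, Complex.norm_real]; exact le_abs_self _
  linarith

/-- On the disc with `r < x`: `z ≠ 0`. -/
theorem stC_ne_zero_of_mem_disc (hrx : r < x) (hz : ‖z - x‖ ≤ r) : z ≠ 0 := by
  intro h
  linarith [stC_norm_ge_sub_of_mem_disc hz, show ‖z‖ = 0 by rw [h, norm_zero]]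

/-- On the disc with `x + r < 1`: `1 − z ≠ 0`. -/
theorem stC_one_sub_ne_zero_of_mem_disc (hx1 : x + r < 1) (hz : ‖z - x‖ ≤ r) : (1 : ℂ) - z ≠ 0 := by
  intro h
  linarith [stC_norm_one_sub_ge_of_mem_disc hz, show ‖(1 : ℂ) - z‖ = 0 by rw [h, norm_zero]]

/-- **`Re(1/z) ≥ 1/(x+r)` on the disc** `|z − x| ≤ r < x` (the disc lies inside the circle `Re(1/z) = 1/(x+r)` through `x + r`). -/
theorem stC_inv_add_le_re_inv (hr : 0 < r) (hrx : r < x) (hz : ‖z - x‖ ≤ r) : (x + r)⁻¹ ≤ (z⁻¹).re := by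
  have hz0 : z ≠ 0 := stC_ne_zero_of_mem_disc hrx hz
  have hns : 0 < Complex.normSq z := Complex.normSq_pos.2 hz0
  rw [Complex.inv_re, le_div_iff₀ hns]
  -- coordinates: a = z.re - x, b = z.im, a² + b² ≤ r²
  have hsq : (z.re - x) ^ 2 + z.im ^ 2 ≤ r ^ 2 := by
    have h1 : ‖z - x‖ ^ 2 ≤ r ^ 2 := pow_le_pow_left₀ (norm_nonneg _) hz 2
    have h2 : ‖z - (x : ℂ)‖ ^ 2 = (z.re - x) ^ 2 + z.im ^ 2 := by
      rw [Complex.sq_norm, Complex.normSq_apply]; simp; ring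
    linarith
  have ha : z.re - x ≤ r := by
    have : (z.re - x) ^ 2 ≤ r ^ 2 := by nlinarith [sq_nonneg z.im]
    exact abs_le_of_sq_le_sq' this hr.le |>.2
  rw [Complex.normSq_apply]
  have hxr : 0 < x + r := by linarith
  -- (x+r)(x+a) - ((x+a)² + b²) ≥ (x+r)(x+a) - ((x+a)² + r² - a²) = (x - r)(r - a) ≥ 0
  have key : (x + r) * z.re - (z.re * z.re + z.im * z.im) ≥ (x - r) * (r - (z.re - x)) := by nlinarith
  have hpos : 0 ≤ (x - r) * (r - (z.re - x)) := mul_nonneg (by linarith) (by linarith)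
  have := inv_mul_cancel₀ (ne_of_gt hxr)
  calc (x + r)⁻¹ * (z.re * z.re + z.im * z.im) ≤ (x + r)⁻¹ * ((x + r) * z.re) := by
        apply mul_le_mul_of_nonneg_left _ (inv_nonneg.2 hxr.le); linarith
    _ = z.re := by rw [← mul_assoc, this, one_mul]

/-- **`Re(1/(1−z)) ≤ 1/(1−x−r)` on the disc** (`x + r < 1`). -/
theorem stC_re_inv_one_sub_le (hx1 : x + r < 1) (hz : ‖z - x‖ ≤ r) : ((1 - z)⁻¹).re ≤ (1 - x - r)⁻¹ := by
  have hpos : 0 < 1 - x - r := by linarith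
  calc ((1 - z)⁻¹).re ≤ ‖(1 - z)⁻¹‖ := Complex.re_le_norm _
    _ = ‖1 - z‖⁻¹ := norm_inv _
    _ ≤ (1 - x - r)⁻¹ := inv_anti₀ hpos (stC_norm_one_sub_ge_of_mem_disc hz)

/-- **Möbius disc bound**: for `0 < r < c` and `‖w − c‖ ≤ r`, `|Im(1/w)| ≤ r/(c² − r²)` (the image of the disc under `w ↦ 1/w` is the
disc with diameter `[1/(c+r), 1/(c−r)]`). -/
theorem stC_abs_im_inv_le_of_disc {c r : ℝ} {w : ℂ} (hr : 0 < r) (hrc : r < c) (hw : ‖w - c‖ ≤ r) :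
    |(w⁻¹).im| ≤ r / (c ^ 2 - r ^ 2) := by
  have hw0 : w ≠ 0 := stC_ne_zero_of_mem_disc hrc hw
  have hD : 0 < c ^ 2 - r ^ 2 := by nlinarith
  set D := c ^ 2 - r ^ 2 with hD_def
  -- coordinates
  have hsq : (w.re - c) ^ 2 + w.im ^ 2 ≤ r ^ 2 := by
    have h1 : ‖w - c‖ ^ 2 ≤ r ^ 2 := pow_le_pow_left₀ (norm_nonneg _) hw 2
    have h2 : ‖w - (c : ℂ)‖ ^ 2 = (w.re - c) ^ 2 + w.im ^ 2 := by
      rw [Complex.sq_norm, Complex.normSq_apply]; simp; ring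
    linarith
  -- ‖D − c·w‖² ≤ r²‖w‖²
  have key : ‖(D : ℂ) - c * w‖ ^ 2 ≤ (r * ‖w‖) ^ 2 := by
    have hre : ((D : ℂ) - c * w).re = D - c * w.re := by simp
    have him : ((D : ℂ) - c * w).im = -(c * w.im) := by simp
    have e1 : ‖(D : ℂ) - c * w‖ ^ 2 = (r ^ 2 + c * (w.re - c)) ^ 2 + c ^ 2 * w.im ^ 2 := by
      rw [Complex.sq_norm, Complex.normSq_apply, hre, him, hD_def]; ring
    have e2 : (r * ‖w‖) ^ 2 = r ^ 2 * ((c + (w.re - c)) ^ 2 + w.im ^ 2) := by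
      rw [mul_pow, Complex.sq_norm, Complex.normSq_apply]; ring
    have e3 : r ^ 2 * ((c + (w.re - c)) ^ 2 + w.im ^ 2) - ((r ^ 2 + c * (w.re - c)) ^ 2 + c ^ 2 * w.im ^ 2)
        = (c ^ 2 - r ^ 2) * (r ^ 2 - (w.re - c) ^ 2 - w.im ^ 2) := by ring
    rw [e1, e2]
    nlinarith [mul_nonneg hD.le (by linarith : (0 : ℝ) ≤ r ^ 2 - (w.re - c) ^ 2 - w.im ^ 2)]
  have key' : ‖(D : ℂ) - c * w‖ ≤ r * ‖w‖ := (abs_le_of_sq_le_sq' key (by positivity)).2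
  -- ‖w⁻¹ − c/D‖ ≤ r/D
  have hwpos : 0 < ‖w‖ := norm_pos_iff.2 hw0
  have hdist : ‖w⁻¹ - (c / D : ℝ)‖ ≤ r / D := by
    have e : w⁻¹ - ((c / D : ℝ) : ℂ) = ((D : ℂ) - c * w) / (D * w) := by
      have hD0 : (D : ℂ) ≠ 0 := by exact_mod_cast hD.ne'
      push_cast
      field_simp
    rw [e, norm_div, norm_mul, Complex.norm_real, Real.norm_of_nonneg hD.le, div_le_div_iff₀ (mul_pos hD hwpos) hD]
    calc ‖(D : ℂ) - c * w‖ * D ≤ r * ‖w‖ * D := by gcongr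
      _ = r * (D * ‖w‖) := by ring
  calc |(w⁻¹).im| = |(w⁻¹ - ((c / D : ℝ) : ℂ)).im| := by simp
    _ ≤ ‖w⁻¹ - ((c / D : ℝ) : ℂ)‖ := Complex.abs_im_le_norm _
    _ ≤ r / D := hdist

/-- `|Im(1/z)| ≤ r/(x² − r²)` on the disc `|z − x| ≤ r < x`. -/
theorem stC_abs_im_inv_le (hr : 0 < r) (hrx : r < x) (hz : ‖z - x‖ ≤ r) : |(z⁻¹).im| ≤ r / (x ^ 2 - r ^ 2) :=
  stC_abs_im_inv_le_of_disc hr hrx hz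

/-- `|Im(1/(1−z))| ≤ r/((1−x)² − r²)` on the disc (`x + r < 1`). -/
theorem stC_abs_im_inv_one_sub_le (hr : 0 < r) (hx1 : x + r < 1) (hz : ‖z - x‖ ≤ r) :
    |((1 - z)⁻¹).im| ≤ r / ((1 - x) ^ 2 - r ^ 2) := by
  have hw : ‖(1 - z) - ((1 - x : ℝ) : ℂ)‖ ≤ r := by
    have : (1 - z) - ((1 - x : ℝ) : ℂ) = -(z - x) := by push_cast; ring
    rw [this, norm_neg]; exact hz
  exact stC_abs_im_inv_le_of_disc hr (by linarith) hw

end geometry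

/-! ## §3 Lower bounds for `|1 + eʷ|` -/

/-- `‖1 + eʷ‖ ≥ e^{Re w} − 1`. -/
theorem stC_norm_one_add_exp_ge_exp_re_sub_one (w : ℂ) : Real.exp w.re - 1 ≤ ‖1 + Complex.exp w‖ := by
  have h : ‖Complex.exp w‖ ≤ ‖1 + Complex.exp w‖ + ‖(1 : ℂ)‖ := by
    calc ‖Complex.exp w‖ = ‖(1 + Complex.exp w) - 1‖ := by ring_nf
      _ ≤ ‖1 + Complex.exp w‖ + ‖(1 : ℂ)‖ := norm_sub_le _ _
  rw [Complex.norm_exp, norm_one] at h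
  linarith

/-- `‖1 + eʷ‖ ≥ 1` when `|Im w| ≤ 3/2` (then `Re eʷ = e^{Re w} cos(Im w) ≥ 0`). -/
theorem stC_norm_one_add_exp_ge_one_of_abs_im_le {w : ℂ} (hw : |w.im| ≤ 3 / 2) : 1 ≤ ‖1 + Complex.exp w‖ := by
  have hpi : (3 : ℝ) / 2 ≤ Real.pi / 2 := by linarith [Real.pi_gt_three]
  have hcos : 0 ≤ Real.cos w.im := by
    apply Real.cos_nonneg_of_mem_Icc
    constructor <;> [linarith [(abs_le.1 (hw.trans hpi)).1]; linarith [(abs_le.1 (hw.trans hpi)).2]]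
  have hre : (1 : ℝ) ≤ (1 + Complex.exp w).re := by
    rw [Complex.add_re, Complex.one_re, Complex.exp_re]
    have := Real.exp_pos w.re
    nlinarith
  exact hre.trans (Complex.re_le_norm _)

/-- `‖1 + e^{a+ib}‖ ≥ |sin b|` always (complete the square: `|1+eʷ|² = (eᵃ + cos b)² + sin² b`). -/
theorem stC_abs_sin_im_le_norm_one_add_exp (w : ℂ) : |Real.sin w.im| ≤ ‖1 + Complex.exp w‖ := by
  have hsq : ‖1 + Complex.exp w‖ ^ 2 = (Real.exp w.re + Real.cos w.im) ^ 2 + Real.sin w.im ^ 2 := by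
    rw [Complex.sq_norm, Complex.normSq_apply, Complex.add_re, Complex.add_im, Complex.one_re, Complex.one_im,
      Complex.exp_re, Complex.exp_im]
    have := Real.sin_sq_add_cos_sq w.im
    linear_combination (Real.exp w.re ^ 2 - 1) * this
  have h1 : Real.sin w.im ^ 2 ≤ ‖1 + Complex.exp w‖ ^ 2 := by rw [hsq]; nlinarith [sq_nonneg (Real.exp w.re + Real.cos w.im)]
  exact abs_le_of_sq_le_sq' (by simpa using h1) (norm_nonneg _) |>.2 |> fun h => by
    rcases le_or_gt 0 (Real.sin w.im) with hs | hs
    · rw [abs_of_nonneg hs]; exact h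
    · rw [abs_of_neg hs]
      have := (abs_le_of_sq_le_sq' (by simpa using h1) (norm_nonneg _)).1
      linarith

/-- `‖1 + eʷ‖ ≥ 1/2` when `|Im w| ≤ 5/2` (`5/2 ≤ 5π/6` and `sin(5π/6) = 1/2`). -/
theorem stC_norm_one_add_exp_ge_half_of_abs_im_le {w : ℂ} (hw : |w.im| ≤ 5 / 2) : 1 / 2 ≤ ‖1 + Complex.exp w‖ := by
  by_cases h32 : |w.im| ≤ 3 / 2
  · linarith [stC_norm_one_add_exp_ge_one_of_abs_im_le h32]
  · rw [not_le] at h32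
    -- 3/2 < |b| ≤ 5/2 ⊂ [π/6, 5π/6], where sin ≥ 1/2
    have hpi3 := Real.pi_gt_three
    have hpi4 := Real.pi_lt_d2  -- π < 3.15
    refine le_trans ?_ (stC_abs_sin_im_le_norm_one_add_exp w)
    -- |sin b| = sin |b| for |b| ≤ π; and sin |b| = sin (π - |b|) with π - |b| ∈ [π - 5/2, π - 3/2] ⊂ (0, π/2]... use sin ≥ on [π/6, 5π/6]
    have hb1 : Real.pi / 6 ≤ |w.im| := by linarith
    have hb2 : |w.im| ≤ 5 * Real.pi / 6 := by linarith
    have hsin : 1 / 2 ≤ Real.sin |w.im| := by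
      -- sin is ≥ 1/2 on [π/6, 5π/6]: by cases around π/2 using monotonicity
      rcases le_or_gt |w.im| (Real.pi / 2) with hle | hgt
      · have hm := Real.strictMonoOn_sin.monotoneOn
        have h1 : Real.pi / 6 ∈ Icc (-(Real.pi / 2)) (Real.pi / 2) := ⟨by linarith, by linarith⟩
        have h2 : |w.im| ∈ Icc (-(Real.pi / 2)) (Real.pi / 2) := ⟨by linarith [abs_nonneg w.im], hle⟩
        have := hm h1 h2 hb1
        rwa [Real.sin_pi_div_six] at this
      · have hm := Real.strictMonoOn_sin.monotoneOn
        have e1 : Real.sin |w.im| = Real.sin (Real.pi - |w.im|) := (Real.sin_pi_sub _).symm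
        have h1 : Real.pi / 6 ∈ Icc (-(Real.pi / 2)) (Real.pi / 2) := ⟨by linarith, by linarith⟩
        have h2 : Real.pi - |w.im| ∈ Icc (-(Real.pi / 2)) (Real.pi / 2) := ⟨by linarith, by linarith⟩
        have := hm h1 h2 (by linarith : Real.pi / 6 ≤ Real.pi - |w.im|)
        rwa [Real.sin_pi_div_six, ← e1] at this
    have habs : |Real.sin w.im| = Real.sin |w.im| := by
      rcases le_or_gt 0 w.im with h | h
      · rw [abs_of_nonneg h]
        exact abs_of_nonneg (by rw [abs_of_nonneg h] at hsin; linarith)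
      · rw [abs_of_neg h] at hsin ⊢
        rw [Real.sin_neg] at hsin
        rw [Real.sin_neg, abs_of_nonpos (by linarith : Real.sin w.im ≤ 0)]
    rw [habs]; exact hsin

/-! ## §4 The majorants of `F` on the disc and its holomorphy there -/

section disc

variable {x r : ℝ} {z : ℂ}

/-- The exponent's real part on the disc: `Re(1/z − 1/(1−z)) ≥ 1/(x+r) − 1/(1−x−r)`. -/
theorem stC_re_exponent_ge (hr : 0 < r) (hrx : r < x) (hx1 : x + r < 1) (hz : ‖z - x‖ ≤ r) :
    (x + r)⁻¹ - (1 - x - r)⁻¹ ≤ (z⁻¹ - (1 - z)⁻¹).re := by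
  rw [Complex.sub_re]
  linarith [stC_inv_add_le_re_inv hr hrx hz, stC_re_inv_one_sub_le hx1 hz]

/-- The exponent's imaginary part on the disc: `|Im(1/z − 1/(1−z))| ≤ r/(x²−r²) + r/((1−x)²−r²)`. -/
theorem stC_abs_im_exponent_le (hr : 0 < r) (hrx : r < x) (hx1 : x + r < 1) (hz : ‖z - x‖ ≤ r) :
    |(z⁻¹ - (1 - z)⁻¹).im| ≤ r / (x ^ 2 - r ^ 2) + r / ((1 - x) ^ 2 - r ^ 2) := by
  rw [Complex.sub_im]
  have h1 := stC_abs_im_inv_le hr hrx hz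
  have h2 := stC_abs_im_inv_one_sub_le hr hx1 hz
  calc |(z⁻¹).im - ((1 - z)⁻¹).im| ≤ |(z⁻¹).im| + |((1 - z)⁻¹).im| := abs_sub _ _
    _ ≤ _ := add_le_add h1 h2

/-- **Majorant, real-part route**: if `τ := 1/(x+r) − 1/(1−x−r) > 0` then on the disc `1 + exp(…) ≠ 0` and `‖F(z)‖ ≤ 1/(e^τ − 1)`. -/
theorem norm_stC_le_of_re (hr : 0 < r) (hrx : r < x) (hx1 : x + r < 1) (hτ : 0 < (x + r)⁻¹ - (1 - x - r)⁻¹)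
    (hz : ‖z - x‖ ≤ r) :
    1 + Complex.exp (z⁻¹ - (1 - z)⁻¹) ≠ 0 ∧ ‖stC z‖ ≤ (Real.exp ((x + r)⁻¹ - (1 - x - r)⁻¹) - 1)⁻¹ := by
  set w := z⁻¹ - (1 - z)⁻¹ with hw
  have hlow : Real.exp ((x + r)⁻¹ - (1 - x - r)⁻¹) - 1 ≤ ‖1 + Complex.exp w‖ := by
    have h1 := stC_norm_one_add_exp_ge_exp_re_sub_one w
    have h2 : Real.exp ((x + r)⁻¹ - (1 - x - r)⁻¹) ≤ Real.exp w.re := Real.exp_le_exp.2 (stC_re_exponent_ge hr hrx hx1 hz)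
    linarith
  have hpos : 0 < Real.exp ((x + r)⁻¹ - (1 - x - r)⁻¹) - 1 := by linarith [Real.add_one_lt_exp hτ.ne']
  refine ⟨fun h => by rw [h, norm_zero] at hlow; linarith, ?_⟩
  rw [stC, norm_inv]
  exact inv_anti₀ hpos hlow

/-- **Majorant, imaginary-part route**: if `r/(x²−r²) + r/((1−x)²−r²) ≤ 3/2` then `‖F(z)‖ ≤ 1` on the disc. -/
theorem norm_stC_le_one_of_im (hr : 0 < r) (hrx : r < x) (hx1 : x + r < 1)
    (hθ : r / (x ^ 2 - r ^ 2) + r / ((1 - x) ^ 2 - r ^ 2) ≤ 3 / 2) (hz : ‖z - x‖ ≤ r) :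
    1 + Complex.exp (z⁻¹ - (1 - z)⁻¹) ≠ 0 ∧ ‖stC z‖ ≤ 1 := by
  set w := z⁻¹ - (1 - z)⁻¹ with hw
  have hlow : 1 ≤ ‖1 + Complex.exp w‖ :=
    stC_norm_one_add_exp_ge_one_of_abs_im_le ((stC_abs_im_exponent_le hr hrx hx1 hz).trans hθ)
  refine ⟨fun h => by rw [h, norm_zero] at hlow; linarith, ?_⟩
  rw [stC, norm_inv]
  exact inv_le_one_of_one_le₀ hlow

/-- **Majorant, imaginary-part route, wide**: if `r/(x²−r²) + r/((1−x)²−r²) ≤ 5/2` then `‖F(z)‖ ≤ 2` on the disc. -/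
theorem norm_stC_le_two_of_im (hr : 0 < r) (hrx : r < x) (hx1 : x + r < 1)
    (hθ : r / (x ^ 2 - r ^ 2) + r / ((1 - x) ^ 2 - r ^ 2) ≤ 5 / 2) (hz : ‖z - x‖ ≤ r) :
    1 + Complex.exp (z⁻¹ - (1 - z)⁻¹) ≠ 0 ∧ ‖stC z‖ ≤ 2 := by
  set w := z⁻¹ - (1 - z)⁻¹ with hw
  have hlow : 1 / 2 ≤ ‖1 + Complex.exp w‖ :=
    stC_norm_one_add_exp_ge_half_of_abs_im_le ((stC_abs_im_exponent_le hr hrx hx1 hz).trans hθ)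
  refine ⟨fun h => by rw [h, norm_zero] at hlow; linarith, ?_⟩
  rw [stC, norm_inv]
  calc ‖1 + Complex.exp w‖⁻¹ ≤ (1 / 2)⁻¹ := inv_anti₀ (by norm_num) hlow
    _ = 2 := by norm_num

/-- `F` is complex-differentiable at every `z ≠ 0, 1` where `1 + exp(1/z − 1/(1−z)) ≠ 0`. -/
theorem differentiableAt_stC (hz0 : z ≠ 0) (hz1 : (1 : ℂ) - z ≠ 0) (hne : 1 + Complex.exp (z⁻¹ - (1 - z)⁻¹) ≠ 0) :
    DifferentiableAt ℂ stC z := by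
  have h1 : DifferentiableAt ℂ (fun z : ℂ => z⁻¹) z := differentiableAt_inv hz0  -- name guess
  have h2 : DifferentiableAt ℂ (fun z : ℂ => (1 - z)⁻¹) z :=
    ((differentiableAt_const (1 : ℂ)).sub differentiableAt_id).inv hz1
  have h3 : DifferentiableAt ℂ (fun z : ℂ => 1 + Complex.exp (z⁻¹ - (1 - z)⁻¹)) z :=
    (differentiableAt_const _).add (h1.sub h2).cexp
  exact h3.inv hne

end disc

/-! ## §5 The real/complex bridge for iterated derivatives -/

/-- Local real restriction of a holomorphic function: on the real points of an open set of holomorphy,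
`(Re f|ℝ)^{(n)}(t) = Re f^{(n)}(t)`. [cite: KrantzParks2002, Prop. 2.2.10] -/
theorem stC_iteratedDeriv_re_ofReal_of_differentiableOn {f : ℂ → ℂ} {U : Set ℂ} (hU : IsOpen U) (hf : DifferentiableOn ℂ f U) :
    ∀ n : ℕ, ∀ t : ℝ, (t : ℂ) ∈ U → iteratedDeriv n (fun s : ℝ => (f s).re) t = (iteratedDeriv n f t).re := by
  intro n
  induction n with
  | zero => intro t _; simp
  | succ n ih =>
    intro t ht
    have hV : IsOpen {s : ℝ | (s : ℂ) ∈ U} := hU.preimage Complex.continuous_ofReal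
    have hev : iteratedDeriv n (fun s : ℝ => (f s).re) =ᶠ[𝓝 t] fun s : ℝ => (iteratedDeriv n f s).re := by
      filter_upwards [hV.mem_nhds ht] with s hs using ih s hs
    rw [iteratedDeriv_succ, hev.deriv_eq, iteratedDeriv_succ]
    have hd : DifferentiableOn ℂ (iteratedDeriv n f) U := by
      rw [iteratedDeriv_eq_iterate]
      exact ((hf.analyticOnNhd hU).iterated_deriv n).differentiableOn
    exact ((hd.differentiableAt (hU.mem_nhds ht)).hasDerivAt.real_of_complex).deriv

/-- **The bridge**: for `x ∈ (0,1)` and a disc `|z − x| < r` (`0 < r < x`, `x + r < 1`) on whose closure `1 + exp(…) ≠ 0`,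
`σ^{(n)}(x) = Re F^{(n)}(x)`, hence `|σ^{(n)}(x)| ≤ ‖F^{(n)}(x)‖`. -/
theorem abs_iteratedDeriv_smoothTransition_le_norm_iteratedDeriv_stC {x r : ℝ} (hr : 0 < r) (hrx : r < x) (hx1 : x + r < 1)
    (hne : ∀ z : ℂ, ‖z - x‖ ≤ r → 1 + Complex.exp (z⁻¹ - (1 - z)⁻¹) ≠ 0) (n : ℕ) :
    |iteratedDeriv n Real.smoothTransition x| ≤ ‖iteratedDeriv n stC x‖ := by
  have hU : IsOpen (ball (x : ℂ) r) := isOpen_ball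
  have hdiff : DifferentiableOn ℂ stC (ball (x : ℂ) r) := fun z hz =>
    (differentiableAt_stC (stC_ne_zero_of_mem_disc hrx (mem_ball_iff_norm.1 hz).le)
      (stC_one_sub_ne_zero_of_mem_disc hx1 (mem_ball_iff_norm.1 hz).le) (hne z (mem_ball_iff_norm.1 hz).le)).differentiableWithinAt
  have h1 : iteratedDeriv n (fun s : ℝ => (stC s).re) x = (iteratedDeriv n stC x).re :=
    stC_iteratedDeriv_re_ofReal_of_differentiableOn hU hdiff n x (mem_ball_self hr)
  -- smoothTransition agrees with Re F near x
  have hev : Real.smoothTransition =ᶠ[𝓝 x] fun s : ℝ => (stC s).re := by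
    have hx0 : 0 < x := by linarith
    have hx1' : x < 1 := by linarith
    filter_upwards [Ioo_mem_nhds hx0 hx1'] with s hs
    rw [stC_ofReal hs.1 hs.2, Complex.ofReal_re]
  rw [hev.iteratedDeriv_eq, h1]
  exact Complex.abs_re_le_norm _

/-! ## §6 The three pointwise Cauchy bounds -/

/-- Cauchy's estimate for `F` on the disc, given a majorant `M` and non-vanishing of `1 + exp(…)` on the closed disc. -/
theorem abs_iteratedDeriv_smoothTransition_le_of_majorant {x r M : ℝ} (hr : 0 < r) (hrx : r < x) (hx1 : x + r < 1)
    (hM : ∀ z : ℂ, ‖z - x‖ ≤ r → 1 + Complex.exp (z⁻¹ - (1 - z)⁻¹) ≠ 0 ∧ ‖stC z‖ ≤ M) (n : ℕ) :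
    |iteratedDeriv n Real.smoothTransition x| ≤ n ! * M / r ^ n := by
  have hne : ∀ z : ℂ, ‖z - x‖ ≤ r → 1 + Complex.exp (z⁻¹ - (1 - z)⁻¹) ≠ 0 := fun z hz => (hM z hz).1
  refine (abs_iteratedDeriv_smoothTransition_le_norm_iteratedDeriv_stC hr hrx hx1 hne n).trans ?_
  have hdiff : DifferentiableOn ℂ stC (closedBall (x : ℂ) r) := fun z hz =>
    (differentiableAt_stC (stC_ne_zero_of_mem_disc hrx (mem_closedBall_iff_norm.1 hz))
      (stC_one_sub_ne_zero_of_mem_disc hx1 (mem_closedBall_iff_norm.1 hz)) (hne z (mem_closedBall_iff_norm.1 hz))).differentiableWithinAt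
  have hdc : DiffContOnCl ℂ stC (ball (x : ℂ) r) := by
    refine DifferentiableOn.diffContOnCl ?_
    rw [closure_ball _ hr.ne']
    exact hdiff
  exact Complex.norm_iteratedDeriv_le_of_forall_mem_sphere_norm_le n hr hdc
    (fun z hz => (hM z (mem_sphere_iff_norm.1 hz).le).2)

/-- **Pointwise Cauchy bound, real-part route**: for `0 < r < x`, `x + r < 1` and `τ = 1/(x+r) − 1/(1−x−r) > 0`,
`|σ^{(n)}(x)| ≤ n!·(e^τ − 1)⁻¹/rⁿ`. [cite: KrantzParks2002, Prop. 2.2.10] -/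
theorem abs_iteratedDeriv_smoothTransition_le_of_re {x r : ℝ} (hr : 0 < r) (hrx : r < x) (hx1 : x + r < 1)
    (hτ : 0 < (x + r)⁻¹ - (1 - x - r)⁻¹) (n : ℕ) :
    |iteratedDeriv n Real.smoothTransition x| ≤ n ! * (Real.exp ((x + r)⁻¹ - (1 - x - r)⁻¹) - 1)⁻¹ / r ^ n :=
  abs_iteratedDeriv_smoothTransition_le_of_majorant hr hrx hx1 (fun _ hz => norm_stC_le_of_re hr hrx hx1 hτ hz) n

/-- **Pointwise Cauchy bound, imaginary-part route**: for `0 < r < x`, `x + r < 1` and `r/(x²−r²) + r/((1−x)²−r²) ≤ 3/2`,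
`|σ^{(n)}(x)| ≤ n!/rⁿ`. [cite: KrantzParks2002, Prop. 2.2.10] -/
theorem abs_iteratedDeriv_smoothTransition_le_of_im {x r : ℝ} (hr : 0 < r) (hrx : r < x) (hx1 : x + r < 1)
    (hθ : r / (x ^ 2 - r ^ 2) + r / ((1 - x) ^ 2 - r ^ 2) ≤ 3 / 2) (n : ℕ) :
    |iteratedDeriv n Real.smoothTransition x| ≤ n ! * 1 / r ^ n :=
  abs_iteratedDeriv_smoothTransition_le_of_majorant hr hrx hx1 (fun _ hz => norm_stC_le_one_of_im hr hrx hx1 hθ hz) n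

/-- **Pointwise Cauchy bound, wide imaginary-part route**: for `0 < r < x`, `x + r < 1` and `r/(x²−r²) + r/((1−x)²−r²) ≤ 5/2`,
`|σ^{(n)}(x)| ≤ 2·n!/rⁿ`. [cite: KrantzParks2002, Prop. 2.2.10] -/
theorem abs_iteratedDeriv_smoothTransition_le_two_of_im {x r : ℝ} (hr : 0 < r) (hrx : r < x) (hx1 : x + r < 1)
    (hθ : r / (x ^ 2 - r ^ 2) + r / ((1 - x) ^ 2 - r ^ 2) ≤ 5 / 2) (n : ℕ) :
    |iteratedDeriv n Real.smoothTransition x| ≤ n ! * 2 / r ^ n :=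
  abs_iteratedDeriv_smoothTransition_le_of_majorant hr hrx hx1 (fun _ hz => norm_stC_le_two_of_im hr hrx hx1 hθ hz) n

end Summit.HubbardSuperconductivity.HubbardSuperconductivity.Theorems.KLRegimeSplit

end
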